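import Mathlib
import Summits.KontsevichZagierPeriods.Zeta5Search.WellPoisedFaceZeta579
import Summits.KontsevichZagierPeriods.Zeta5Search.WellPoisedFaceOddGrowth
import HarnessLib.Audit
import HarnessLib

/-!
# Growth of the integer-normalised forms on the numerator-free face for every `q ≤ 11`
# (windows `{ζ(5)}`, `{ζ(5),ζ(7)}`, `{ζ(5),ζ(7),ζ(9)}`), modulo the decay floor — cell `pub-zeta5`, class `odd`
# (gen 7), target T4 (structural no-go serving T2)

HONEST FRAMING: systematic search; no irrationality claim unless certified.  A NEGATIVE result about a printed
construction; nothing here is a candidate or an irrationality claim.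

Provenance: family-designer seat `pub-zeta5-fam-odd-g7` (planner role; staged under
`run/shared/lean/pub/pub-zeta5/lean/fam-odd/`; `families/odd/FAMILY.md` §5.11) for VERBATIM filing by the lane AFTER
`WellPoisedFaceOddGrowth` (class `odd` gen 6) and `WellPoisedFaceZeta579` (gen 7) are in the tree.  Not literature.
Source (PRINTED): W. Zudilin, J. Théor. Nombres Bordeaux 16 (2004) 251–291 = arXiv:math/0206176, §8
[cite: Zudilin2004, §8: (8.6)–(8.9), Lemma 19, (8.13), Lemma 20, Prop. 5]; dictionary as in `WellPoisedFaceZeta57`.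

## Content (ten lines of glue; the two inputs are the theorems)
`IntFaceDir.faceLambda_eventually_ge` (gen 6, every `M`: under the decay floor `|F n| ≥ e^{−(C₀+ε)n}`,
eventually `|Λ_n(F)| ≥ exp((δ − φ⁺ − C₀ − ε)n)`, with `δ` the EXACT rate of `D_{M₁}^3 ⋯ D_{M_{q−3}}` by PNT for
`ψ` and `φ⁺ ≥` the kernel `Φ`-saving bound by PNT for `θ`) `+` `FaceDirM.face_gap_le_six` (gen 7, `M ≤ 6`:
`δ − φ⁺ − C₀ ≥ η₀/25 > 0`, the `η₄`-coupled Gibbs-tangent envelope) `⟹`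
**`IntFaceDir.faceLambda_tendsto_atTop_le_six` (`M ≤ 6`, i.e. `q ≤ 11`): `|Λ_n(F)| → +∞`.**
With `F n = F(h_n)` of (8.6) and Lemma 19 [PRINTED], the `Λ_n` are Zudilin's integer-normalised linear forms in
`1` and the odd zeta values of the window; on the whole numerator-free face of every box `q ≤ 11` they GROW, so
Proposition 5 never applies there, at any height — for every window strictly inside Zudilin's Theorem 3
(`q = 13`, `{ζ(5), ζ(7), ζ(9), ζ(11)}`).  The gen-6 theorem `faceLambda_tendsto_atTop` is the case `M ≤ 4`.
Kernel instance `modelFace11Int = (200; 42, 43, …, 48, 71)` (`M = 6`, the float arg-min shape; `φ⁺_ℕ = 770`,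
`δ = 1530` by `decide`).
## What is NOT proved here
The decay floor itself (hypothesis `hF`; for `q = 7` it follows from fam-vwp's UNCONDITIONAL face rate
`WellPoisedFaceSandwich.tendsto_log_faceF_div`, `Fin 4` setting — porting it to `FaceDirM M` is census item R12 of
FAMILY.md §9, not done); anything off the face; Lemma 19 membership (PRINTED).  See the two imported files.
-/

noncomputable section

open Real Finset Filter Topology

namespace Summit.KontsevichZagierPeriods.Zeta5Search

namespace WellPoisedFace

namespace IntFaceDir

variable {M : ℕ} (E : IntFaceDir M)

/-- **THE FACE THEOREM, END TO END MODULO THE DECAY FLOOR, for every `q ≤ 11` (`M ≤ 6`: windows `{ζ(5)}`,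
`{ζ(5),ζ(7)}`, `{ζ(5),ζ(7),ζ(9)}`).**  If `|F n| ≥ exp(−(C₀ + ε)n)` eventually for every `ε > 0`, then
`|Λ_n(F)| → +∞`: the exponent `δ − φ⁺ − C₀` is `≥ η₀/25 > 0` (`FaceDirM.face_gap_le_six`). -/
theorem faceLambda_tendsto_atTop_le_six (hM : M ≤ 6) (F : ℕ → ℝ)
    (hF : ∀ ε : ℝ, 0 < ε → ∀ᶠ n : ℕ in atTop, Real.exp (-(E.real.C0 + ε) * n) ≤ |F n|) :
    Tendsto (fun n : ℕ => |E.faceLambda F n|) atTop atTop := by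
  have hgap := E.real.face_gap_le_six hM
  have hη := E.real.η₀_pos
  have hpos : 0 < E.real.delta - E.real.phiPlus - E.real.C0 := by linarith
  have hev := E.faceLambda_eventually_ge F hF (half_pos hpos)
  have hexp : Tendsto (fun n : ℕ => Real.exp ((E.real.delta - E.real.phiPlus - E.real.C0
      - (E.real.delta - E.real.phiPlus - E.real.C0) / 2) * n)) atTop atTop :=
    Real.tendsto_exp_atTop.comp (tendsto_natCast_atTop_atTop.const_mul_atTop (by linarith))
  exact tendsto_atTop_mono' atTop hev hexp

/-! ### Kernel instance: the float arg-min shape of the `q = 11` face -/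

/-- `(200; 0,0,0, 42, 43,44,45,46,47,48, 71)`: the integral shape of `FaceDirM.modelFace11`. -/
def modelFace11Int : IntFaceDir 6 where
  η₀ := 200
  tail := ![42, 43, 44, 45, 46, 47, 48, 71]
  hlo := by decide
  hhi := by decide
  hd := by decide

/-- `φ⁺_ℕ = 116 + 114 + 112 + 110 + 108 + 106 + 104 = 770` (seven alive bricks; the top tail `71` is dead). -/
example : modelFace11Int.phiPlusN = 770 := by decide

/-- `δ = 3·μ(42) + μ(43) + ⋯ + μ(48) + μ(71) = 3·158 + (157 + ⋯ + 152) + 129 = 1530` (`μ(71) = max{116, 129}`). -/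
example : 3 * modelFace11Int.mu modelFace11Int.a + ∑ j, modelFace11Int.mu (modelFace11Int.mid j)
    + modelFace11Int.mu modelFace11Int.d = 1530 := by decide

/-- … so on that ray the normalised forms grow under the decay floor (`1530 − 770 = 760 > C₀`). -/
example (F : ℕ → ℝ)
    (hF : ∀ ε : ℝ, 0 < ε → ∀ᶠ n : ℕ in atTop, Real.exp (-(modelFace11Int.real.C0 + ε) * n) ≤ |F n|) :
    Tendsto (fun n : ℕ => |modelFace11Int.faceLambda F n|) atTop atTop :=
  modelFace11Int.faceLambda_tendsto_atTop_le_six le_rfl F hF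

end IntFaceDir

end WellPoisedFace

end Summit.KontsevichZagierPeriods.Zeta5Search
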